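import Mathlib
import HarnessLib
import HarnessLib.Audit
import Summits.Langlands.Statement
import HarnessLib.Audit.Status.Attr

/-!
Route: CapacityClassicality

DORMANT since 2026-08-23T05:17:13Z (reconciler: no traction for 5.9 d (last activity item-evidence-added at 2026-08-17T06:27:22Z); parked, not closed — `ledger route dormant route-Langlands-CapacityClassicality --off` to reactivate) — unstaffed, not closed; items shared with open routes are served there. `ledger route dormant <id> --off` reactivates.

# Route CapacityClassicality — Arakelov degree instead of analytic continuation — BCL capacity makes
E-integral overconvergent forms congruence-classical, a weight-blind engine for (B)

It suffices to show X = X_ℚ ∧ X_F. X_ℚ (typed here) = α ∧ β′: (α,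
`IntegralOverconvergentIsCongruence`) for p ≥ 5, p ∤ N, every
overconvergent p-adic modular form g of INTEGER weight k and tame level Γ₁(N) (any slope, any sign
of k; stated through its Katz
expansion g = Σ_i c_i E_(p-1)^(-i), c_i classical of weight k+i(p−1), ‖c_i‖_p ≤ C p^(−ri), r > 0)
whose q-expansion lies in O_E[[q]] for a
number field E and converges on the unit disc under EVERY complex embedding is congruence-classical
up to cusp poles: g·Δ^m is a classical
form on some Γ₁(M); (β′, `EigenIntegralOverconvergentIsClassical`, Mathlib-only) hence such a
q-expansion that is moreover normalised
(a₁ = 1) and T_ℓ-eigen in q-expansion form for every prime ℓ ∤ Np is ITSELF the q-expansion of a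
classical modular form of weight k on some
Γ₁(M) (no Δ-power). The Galois-level reading β (an irreducible ρ : G_ℚ → GL₂(ℚ̄_p) whose Frobenius
polynomials are those of such an
E-integral eigen q-expansion is a classical newform's representation) is β′ + Atkin–Lehner–Li +
Deligne/Deligne–Serre + Chebotarev–Brauer–Nesbitt,
all known, and rides inside SectorToLanglands; its typed form ERationalOverconvergentClassical
(stmt-Langlands-8458) was dropped at the
2026-08-15 cone repair because its vocabulary imported
Literature.NumberTheory.EllipticCurves.NewformGaloisRep and with it three unproved XL
named facts (Deligne, Deligne–Serre, Eichler–Shimura) that no item of this route uses. X_F (informal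
crux HilbertIntegralOverconvergentIsCongruence,
rank 4, plus avatar supply) = the same engine for Hilbert modular forms over totally real F plus
avatar supply at every weight, partial weight
one included; X → (B) for n = 2 on the totally-odd E-rational sector, the honest remainder being the
imported-complement item
SectorToLanglands (β′ → Langlands, lowest rank, never glue). Realises card
capacity-classicality-overconvergent (spine).
Lean: `(∀ (p : ℕ) [Fact p.Prime] (hp : 5 ≤ p) (N : ℕ) [NeZero N], ¬ p ∣ N → ∀ (k : ℤ) (ι :
PadicAlgCl p ≃+* ℂ) (E : Type) [Field E] [NumberField E] (σ₀ : E →+* ℂ) (a : ℕ → E), (∀ n,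
IsIntegral ℤ (a n)) → (∀ (σ : E →+* ℂ) (t : ℝ), 0 < t → t < 1 → ∃ C : ℝ, ∀ n, ‖σ (a n)‖ * t ^ n ≤ C)
→ (∃ (r C : ℝ) (c : ℕ → PowerSeries ℂ), 0 < r ∧ (∀ i : ℕ, ∃ F : ModularForm
(CongruenceSubgroup.Gamma1 N) (k + i * (p - 1 : ℕ)), c i = UpperHalfPlane.qExpansion 1 ⇑F) ∧ (∀ i n
: ℕ, ‖ι.symm (PowerSeries.coeff n (c i))‖ ≤ C * (p : ℝ) ^ (-(r * i))) ∧ ∀ n : ℕ, HasSum (fun i : ℕ ↦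
ι.symm (PowerSeries.coeff n (c i * ((UpperHalfPlane.qExpansion 1 ⇑(ModularForm.E (show 3 ≤ p - 1 by
omega)))⁻¹) ^ i))) (ι.symm (σ₀ (a n)))) → ∃ (M : ℕ) (_ : NeZero M) (m : ℕ) (F : ModularForm
(CongruenceSubgroup.Gamma1 M) (k + 12 * m)), UpperHalfPlane.qExpansion 1 ⇑F = PowerSeries.mk (fun n
↦ σ₀ (a n)) * (UpperHalfPlane.qExpansion 1 ⇑CuspForm.discriminant) ^ m) ∧ (∀ (p : ℕ) [Fact p.Prime]
(hp : 5 ≤ p) (N : ℕ) [NeZero N], ¬ p ∣ N → ∀ (k : ℤ) (ι : PadicAlgCl p ≃+* ℂ) (E : Type) [Field E]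
[NumberField E] (σ₀ : E →+* ℂ) (a : ℕ → E) (ψ : DirichletCharacter ℂ N), a 1 = 1 → (∀ n, IsIntegral
ℤ (a n)) → (∀ (σ : E →+* ℂ) (t : ℝ), 0 < t → t < 1 → ∃ C : ℝ, ∀ n, ‖σ (a n)‖ * t ^ n ≤ C) → (∃ (r C
: ℝ) (c : ℕ → PowerSeries ℂ), 0 < r ∧ (∀ i : ℕ, ∃ F : ModularForm (CongruenceSubgroup.Gamma1 N) (k +
i * (p - 1 : ℕ)), c i = UpperHalfPlane.qExpansion 1 ⇑F) ∧ (∀ i n : ℕ, ‖ι.symm (PowerSeries.coeff n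
(c i))‖ ≤ C * (p : ℝ) ^ (-(r * i))) ∧ ∀ n : ℕ, HasSum (fun i : ℕ ↦ ι.symm (PowerSeries.coeff n (c i
* ((UpperHalfPlane.qExpansion 1 ⇑(ModularForm.E (show 3 ≤ p - 1 by omega)))⁻¹) ^ i))) (ι.symm (σ₀ (a
n)))) → (∀ ℓ n : ℕ, ℓ.Prime → ¬ ℓ ∣ N * p → 0 < n → σ₀ (a (ℓ * n)) + (if ℓ ∣ n then ψ ℓ * (ℓ : ℂ) ^
(k - 1) * σ₀ (a (n / ℓ)) else 0) = σ₀ (a ℓ) * σ₀ (a n)) → ∃ (M : ℕ) (_ : NeZero M) (G : ModularForm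
(CongruenceSubgroup.Gamma1 M) k), UpperHalfPlane.qExpansion 1 ⇑G = PowerSeries.mk (fun n ↦ σ₀ (a
n)))`

## Assembly
Pure logic, certified by the deciding theorem `closes : IntegralOverconvergentIsCongruence →
CongruenceToClassical → SectorToLanglands →
Langlands := fun hα hαβ hβL => hβL (hαβ hα)` (H21 audit ok, axioms propext / Classical.choice /
Quot.sound): α and the glue
CongruenceToClassical give β′; SectorToLanglands carries β′ to the summit constant. The mathematical
content is α (rank 2), the independent
refutability of β′ (rank 3), and — outside the typed layer — the Hilbert engine (rank 4) and avatar
supply.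

Rationale: WHY THIS LINE. The classicality step of every irregular-weight case of (B) is today ONE-PRIME p-adic
analysis (Coleman1996 slopes; BuzzardTaylor1999 /
Kassaei / Pilloni–Stroh gluing; Kisin2003, Emerton2011LocalGlobal, Pan2022LocallyAnalytic p-adic
Hodge theory) and stalls exactly where the
barriers say: weight ≤ 1, infinite slope, F_v ≠ ℚ_p. This line imports ARITHMETIC ALGEBRAIZATION
from transcendence theory
(BostChambertloir2007 = BCL, Thm 2: an A-analytic formal curve whose tangent line has positive
Arakelov degree for the canonical
semi-norms is algebraic; Prop 19: canonical ≤ capacitary semi-norm of (M^an ∖ U, O), U affinoid) and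
the unbounded-denominators
theorem (CalegariDimitrovTang2025, Thm 1): the graph of the section g in P(ω^k ⊕ O) over X_μ(N) has
size 1 at every λ ∤ p
(O_E-integrality, Prop 9), capacitary norm 1 at every archimedean place (unit q-disc), and at the
prime of overconvergence the wide open
{v(E_(p-1)) < r} has Robin constant (r log p)/s_N > 0 at ∞ (harmonic balance at the Gauss point; toy
check on P¹ reproduces Borel–Dwork),
so deg^ > 0, g is algebraic over ℚ̄(X_μ(N)), hence modular of weight k on a finite-index subgroup,
hence congruence by CDT. The
inequality never sees U_p-slopes, Sen operators or F_v — overconvergence at one prime is paid for by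
integrality everywhere else and
boundedness at infinity (the rank-2 analogue of Serre–Waldschmidt "E-rational abelian ⇒ locally
algebraic"); no prior route or negative
of this summit uses a product-formula/height argument for classicality (DegenerateLimits, CMFern,
NewtonPatching interpolate inside
p-adic geometry; the one refuted statement, K3KugaSatake's Serre-type anchor, is unrelated).

RANKED CRUXES. #2 IntegralOverconvergentIsCongruence (crux) — THEOREM α over ℚ (card C1, corrected
to "up to a power of Δ"): p ≥ 5 prime, N ≥ 1 with p ∤ N, k ∈ ℤ, ι : ℚ̄_p ≃ ℂ, E a number field with
an embedding σ₀, a : ℕ → O_E (algebraic integers). If Σ σ(a_n) qⁿ has radius ≥ 1 for every σ : E →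
ℂ, and g := Σ σ₀(a_n) qⁿ is p-adically overconvergent of weight k and tame level Γ₁(N) in the
Katz-expansion sense (g = Σ_i c_i E_(p-1)^(−i) coefficientwise in ℚ̄_p along ι⁻¹, c_i q-expansions
of classical forms in M_(k+i(p−1))(Γ₁(N)), ‖ι⁻¹c_i‖ ≤ C p^(−ri), r > 0), then for some level M and m
≥ 0, g·Δ^m is the q-expansion of a classical modular form of weight k + 12m on Γ₁(M). (The Δ-power
is necessary: t = (η(pτ)/η(τ))^(24/(p−1)), p = 5, 7, 13, is overconvergent of weight 0, integral,
radius 1, with a pole at the cusp 0.) [difficulty: XL] (why it might fail: deg^>0 needs a term ≥0 at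
EVERY other place: a prime of bad reduction of X_μ(N), a cusp not smooth in the model, or the fibre
coordinate of P(ω^k⊕O) could hide a negative canonical term larger than the tiny gain (r log p)/s_N;
level-N Robin positivity is computed, not printed.) [BostChambertloir2007, CalegariDimitrovTang2025,
arXiv:2109.09040, Katz1973, Coleman1996]
#3 EigenIntegralOverconvergentIsClassical (crux) — COROLLARY β′ over ℚ at the q-expansion level
(Mathlib-only; replaces the Galois-level β = ERationalOverconvergentClassical, stmt-Langlands-8458,
dropped at the cone repair): p ≥ 5, p ∤ N, k ∈ ℤ, ι : ℚ̄_p ≃ ℂ, ψ a Dirichlet character mod N, E a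
number field with σ₀ : E → ℂ, a : ℕ → O_E with a₁ = 1. If Σ σ(a_n) qⁿ has radius ≥ 1 for every σ : E
→ ℂ, g := Σ σ₀(a_n) qⁿ is p-adically overconvergent of weight k and tame level Γ₁(N) in the
Katz-expansion sense along ι (exactly as in α), and g is T_ℓ-eigen in q-expansion form for every
prime ℓ ∤ Np (a_(ℓn) + ψ(ℓ)ℓ^(k−1) a_(n/ℓ) = a_ℓ a_n, n ≥ 1), then g ITSELF is the q-expansion of a
classical modular form of weight k on some Γ₁(M) — no Δ-power (k ≤ 0 vacuous: integrality of a(ℓ²) =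
a(ℓ)² − ψ(ℓ)ℓ^(k−1) at two primes fails). Follows from α by cusp-pole removal alone (V_ℓ multiplies
the worst cusp-pole order of F/Δ^m by ℓ, U_ℓ and a_ℓ·g do not; one prime ℓ ∤ MNp suffices). Galois
reading (informal, carried by SectorToLanglands): Atkin–Lehner–Li + Deligne / Deligne–Serre +
Chebotarev–Brauer–Nesbitt turn β′ into 'an irreducible ρ : G_ℚ → GL₂(ℚ̄_p) with charpoly(Frob_ℓ) =
X² − ι⁻¹(a_ℓ)X + ι⁻¹(ψ(ℓ)ℓ^(k−1)) at ℓ ∤ Np is ρ_f for a classical newform f'; with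
Pan2022LocallyAnalytic Thm 1.0.7 (avatar supply over ℚ): odd promodular ρ with HT–Sen weights {0,
k−1} and E-INTEGRAL archimedean-bounded traces is modular — de Rham is an output. [deps:
IntegralOverconvergentIsCongruence] [difficulty: open-problem] (why it might fail: β′ sees the
q-expansion, not only the eigensystem: ONE non-classical T_ℓ-eigen (ℓ ∤ Np) overconvergent
q-expansion with a₁ = 1, O_E-integral, radius ≥ 1 kills it — an E-rational eigencurve point of
weight ≤ 1 (Hida2010 bounds Hecke fields only at classical points) or an overconvergent f-isotypic
V-tower outside span(α^m, β^m); θ-critical companions fail (Bellaiche–Chenevier: some T_ℓ acts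
non-semisimply); none known.) [Coleman1996, Kisin2003, Hida2010, Bellaiche2009, Majumdar2013,
BellaicheChenevier2004, Pan2022LocallyAnalytic, arXiv:2008.07099, Katz1973]
#4 HilbertIntegralOverconvergentIsCongruence (crux, informal until HilbertModularFormQExpansion
lands) — HILBERT ENGINE (card C2): F totally real, p ≥ 5 unramified in F and prime to the tame level
𝔫, E a number field; an overconvergent Hilbert modular form (Andreatta–Iovita–Pilloni / Kisin–Lai
strict neighbourhood of the ordinary-multiplicative locus, level Γ₁(𝔫)) of INTEGER paritious weight
(k_σ) — partial weight one allowed — whose q-expansion at the standard cusp has coefficients in O_E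
and converges on the whole tube domain under every complex embedding of E becomes classical after
multiplication by a classical cusp-vanishing form of parallel weight. (why it might fail: BCL Thm 2
is for CURVES; higher-dimensional criteria (Bost 2001 Thm 3.4, Bost 2004) need archimedean largeness
the unit polydisc lacks; slice-wise algebraic ⊬ algebraic; p inert: partial Hasse invariants only.)
[BostChambertloir2007, doi:10.1007/s10240-001-8191-3, AndreattaGoren2005, CalegariDimitrovTang2025]
#9 ArchimedeanSlackNeeded (support) — Sharpness of α (the archimedean term is load-bearing): for p =
5, g = 1/E₄ has a one-term Katz expansion (c₁ = 1, weight −4 + 4 = 0), integer coefficients, and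
g·Δ^m is never classical (E₄(ρ) = 0 from S- and T-invariance at ρ = e^(2πi/3), Δ(ρ) ≠ 0); its
complex radius is e^(−π√3) < 1. Provable from Mathlib (qExpansion injectivity, slash invariance of
E₄, discriminant_ne_zero). [difficulty: M] [Katz1973, Coleman1996]
#9 CongruenceToClassical (support) — Glue α → β′ (replaces CongruenceToGalois = α → β): from α, g =
F/Δ^m is a meromorphic modular form of weight k on Γ₁(M), holomorphic on ℍ and at ∞; a T_ℓ-eigen (ℓ
∤ MNp) meromorphic form is holomorphic at every cusp (the V_ℓ-term of U_ℓ g + ψ(ℓ)ℓ^(k−1) V_ℓ g =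
a_ℓ g has exponential growth rate ℓ·R(g) at the worst cusp, every other term ≤ R(g), so R(g) = 0),
hence g is a classical form of weight k on Γ₁(M) with the given q-expansion — exactly β′'s
conclusion; weight k ≤ 0 is vacuous (a₁ = 1 and integrality). Mathlib-level: slash action on cusps,
qExpansion injectivity, V_ℓ/U_ℓ on q-expansions. [difficulty: L] [AtkinLehner1970,
Ribet1977Nebentypus, Katz1973]
#9 SectorToLanglands (crux, rank 9 = imported complement, never glue, not to be staffed from this
route) — OUT-OF-SCOPE REMAINDER, filed only so that the deciding theorem honestly ends at the
summit: EigenIntegralOverconvergentIsClassical → Langlands. It contains the Galois dressing of β′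
(Atkin–Lehner–Li newform of the eigensystem; Deligne / Deligne–Serre representations = the
Literature facts exists_padicGaloisRep_of_isNewform1 / exists_complexGaloisRep_of_weight_one, no
longer imported here; Chebotarev + Brauer–Nesbitt), the informal layer-1 cruxes of this route over
totally real F (HilbertIntegralOverconvergentIsCongruence rank 4; OverconvergentAvatarSupply, to be
filed when typable), local–global compatibility at every place for the classical π produced
(Carayol, Saito, Skinner; T. Liu), and everything this thesis does not claim: even ρ,
non-totally-real F, n ≥ 3, direction (A), the reciprocity data 𝓡. (why it might fail: false iff the
formal summit statement fails outside the totally-odd E-rational GL₂ sector while β′ holds.)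
[difficulty: open-problem] [BuzzardGeeLMS2014, FontaineMazurGeometric1995, DeligneSerreASENS1974]

TWO-LAYER PLAN. Foreseen glued splits, filed only after a crux closes (k ≤ 3, depth 1): α ⇐
FiniteIndexModularity (BCL Thm 2 + Prop 19 + Prop 9 applied to
the graph of g in P(ω^k ⊕ O): g is a weight-k meromorphic modular form on a finite-index Γ' ∋ T) →
CongruenceUpgrade (CDT Thm 1 with
O_E coefficients, meromorphic at cusps) → α; FiniteIndexModularity ⇐ PadicRobinPositive (capacitary
norm of ∂/∂q at ∞ for
X_μ(N)^an ∖ {v(E_(p−1)) ≥ r} equals p^(−r/s_N) < 1) → IntegralModelSizes (μ_N-cusp is a smooth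
ℤ-point with parameter q; sizes 1 at λ ∤ p)
→ FiniteIndexModularity. β′ ⇐ α + EigenMeromorphicIsHolomorphic (the whole of CongruenceToClassical;
NewformOfEigensystem and the Galois
dressing moved to SectorToLanglands). Hilbert α ⇐ curve-slicing
by the modular curves C_ε through the cusp (each slice is α over ℚ) → rigid-analytic upgrade from
slices to the [F:ℚ]-dimensional germ.

KILL CRITERIA. An explicit overconvergent form of integer weight with O_E coefficients, radius ≥ 1
at every embedding, and g·Δ^m non-classical for all m
refutes IntegralOverconvergentIsCongruence and closes the route (`close --reason
refuted:IntegralOverconvergentIsCongruence`); so does a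
place-by-place computation showing a NEGATIVE canonical term at some λ ∤ p for integral g (then BCL
gives nothing). A non-classical overconvergent T_ℓ-eigen
q-expansion with a₁ = 1, O_E-integral coefficients and radius ≥ 1 at every embedding (e.g. the
avatar of a promodular ρ with E-integral
bounded traces) refutes β′: if α survives, pivot β′ to "eigen for ALL Hecke operators incl. U_p and
⟨d⟩" (the glue CongruenceToClassical was
wrong); if α dies too, close. Hilbert α refuted by a genuinely higher-dimensional phenomenon
(curve-wise algebraic but not algebraic) ⇒ the route shrinks to ℚ (reproofs only) ⇒ dormant. If
partial-weight-one (B) over F is proved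
elsewhere (CMFern/NewtonPatching-type routes) the summit-facing value is mooted but α, β′ stay
theorem-candidates.

NOT DECOMPOSED YET. The p-adic potential theory (Thuillier/Rumely Green functions on X_μ(N)^an, the
star-graph balance V = (r log p)/s_N), the integral-model
facts at the μ_N-cusp, the archimedean capacitary norm of the unit disc (Bost 2004), the
Katz-surrogate ⇔ genuine-overconvergent
equivalence (Katz1973 §2.6 + Ax–Sen–Tate), and the CDT input format are layer-2 children of α, not
items. The Hilbert engine (rank 4) and
avatar supply (rank 5: Hida R^ord = T^ord + specialisation, SkinnerWiles1999/Fujiwara; finite slope: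
patched eigenvarieties; over ℚ known by
Emerton2011LocalGlobal + Pan2022LocallyAnalytic Thm 1.0.7) are filed informally after open and typed
once definition requests
OverconvergentModularForm / HilbertModularFormQExpansion land. LGC at ramified places and at p for
the output π sits in SectorToLanglands.

CHEAPEST FALSIFIER. Hunt the literature and LMFDB-style tables for ONE non-classical overconvergent
form of integer weight with algebraic-integer Fourier
coefficients in a number field and complex radius ≥ 1. Candidates already run by hand (all
consistent): E_2 (not overconvergent,
Coleman–Gouvêa–Jochnowitz); ordinary p-adic Eisenstein series of weight 2−k ≤ 0 (coefficients
Σ_(p∤d|n) d^(1−k): unbounded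
denominators); 1/E_(p−1) and θ-images of weight-0 units (radius < 1, poles/zeros in ℍ); p-depletions
and V-images (classical of level
Np²); θ^(k−1) of weight-(2−k) forms with cusp-0 poles (Bol: classical meromorphic); t =
(η(5τ)/η(τ))^6 (classical weight 0 with a pole at
0 — this is what forced the Δ^m in α). Second cheapest: recompute the sign of the 5-adic Robin
constant at level 1 (f = 5^(−3r)·j,
‖∂_q‖^cap = 5^(−3r) < 1: done, positive gain 3r log 5).

NUMBERS. Gain at the prime of overconvergence: −log‖∂_q‖^cap = (r log p)/s_N with s_N = number of
supersingular residue discs of X_μ(N) (level 1,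
stacky count (p−1)/12: 12r log p/(p−1); p = 5: 3r log 5). All other places contribute ≥ 0 (sizes 1;
unit disc). Overconvergence radius
needed: any r > 0 (r < p/(p+1) for the canonical-subgroup description; r < 1 for independence of the
Hasse lift). CDT needs integral
(bounded-denominator) coefficients: O_E. Items at open: 6 (2 cruxes, 3 support, 1 assembly). After
the
2026-08-15 cone repair: 4 cruxes (α r2, β′ r3, Hilbert engine r4 informal, SectorToLanglands r9
imported complement), 2 support (ArchimedeanSlackNeeded,
CongruenceToClassical), 1 assembly, deciding theorem `closes`; extra imports none (cone = Mathlib +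
the summit Statement).

DEFINITION REQUESTS. OverconvergentModularForm (Literature/NumberTheory/Automorphic):
r-overconvergent p-adic modular forms of integer weight k and tame
level Γ₁(N) over a p-adic field, q-expansion map, Katz expansion theorem (Katz1973 Prop 2.6.1/2.6.2)
and Coleman's embedding of
M_k(Γ₁(N) ∩ Γ₀(p)) as named facts — to replace the surrogate in α/β′. HilbertModularFormQExpansion
(same topic): Hilbert modular forms of
weight (k_σ) over totally real F with q-expansions at the standard cusp, and their overconvergent
(Andreatta–Iovita–Pilloni) version —
needed to type the rank-4/5 cruxes. Cite facts wanted: BCL Thm 2 + Prop 19 (needs Arakelov-degree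
vocabulary: long-term), CDT Thm 1
(typable now over Mathlib's finite-index ModularForm), Pan2022LocallyAnalytic Thm 1.0.7.

Novelty: Searches (2026-08-15): lit read arXiv:math/0702593 (BCL: Thm 2 p.25, Prop 19 p.21, Prop 9 p.10
verified), arXiv:2109.09040 (CDT Thm 1
p.3: meromorphic at cusps, number fields OK), arXiv:2008.07099 pp.1–8 (Pan Thm 1.0.4/1.0.5/1.0.7),
Coleman–Mazur "The Eigencurve" §1 open
questions (pp.4–6: no algebraicity question); `lit search` "overconvergent modular forms bounded
denominators classical" (local 6 / crossref
8: Coleman 1996/1997, AIP, Kassaei — all one-prime), `--source zbmath` "overconvergent modular forms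
algebraization" (1: Dwork-theory
volumes), "Borel-Dwork modular curve rationality p-adic" (0), `--source arxiv` "overconvergent
modular form integral Fourier coefficients
classical criterion" (0), `--hybrid` "Bost Chambert-Loir algebraicity criterion capacity p-adic
modular curve supersingular" (8 books, none
relevant); `lit galaxy search --star all` "overconvergent modular forms unbounded denominators" (0),
"Borel-Dwork" (2 unrelated books),
"Questions about slopes of modular forms" (Kilford's book, Buzzard–Kilford), pdf `--mode
intelligent` on the mechanism (10 rows, noise);
`lit frontier Langlands --since 2022` (30 rows, nothing on algebraization), `lit bridges Langlands
--cross any`. lit want acq-02572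
(Buzzard, Astérisque 298) filed to check whether "algebraic eigenvalues ⇒ classical?" is asked
there.
Nearest prior art found: BostChambertloir2007 (doi:10.1007/978-0-8176-4745-2_3; Thm 2/Prop 19,
applications to ODE germs and Borel–Dwork
on curves, never to sections ov  [refs: 10.1007/978-0-8176-4745-2_3, math/0702593, 2109.09040, 2008.07099, doi:10.1007/978-0-8176-4745-2_3, BostChambertloir2007, CalegariDimitrovTang2025, Kisin2003, Coleman1996]

Barriers (technique_class: arithmetic-algebraization capacity transcendence): - technique_class: arithmetic-algebraization capacity transcendence
- Literature.Barriers.Langlands.NonRegularWeightBarrier: evaded for the classicality step — no Betti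
or coherent cohomology class, no interpolation and no patching is used; weight enters α only through
the Katz expansion and may be ≤ 1 (weight one, partial weight one, infinite slope); the barrier's
proved kernel (cohomological types are regular) is untouched; it still binds the AVATAR SUPPLY crux
over F, which is why that crux is ranked separately.
- Literature.Barriers.Langlands.ModPLanglandsGL2BeyondQp: evaded by α/β (the inequality never sees
F_v or any p-adic local Langlands input; over ℚ Pan's Thm 1.0.7 used for avatar supply does use
Colmez's Kirillov model, but the ordinary case needs only Hida theory); over F_v ≠ ℚ_p the residue
sits entirely in OverconvergentAvatarSupply — the bet is that ordinary/finite-slope avatars (Hida,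
patched eigenvarieties) suffice for the E-rational sector.
- Literature.Barriers.Langlands.PatchingLocalComponentBarrier: not engaged by the classicality
engine (no R = T); inherited by avatar supply exactly as in every (B) route; nothing new claimed
there.
- Literature.Barriers.Langlands.ShimuraVarietyRealizationBarrier: respected, not evaded — the engine
needs q-expansions, hence GL₂ over totally real F (modular and Hilbert modular varieties); nothing
is claimed for CM or mixed fields or n ≥ 3 (GSp₄/U(n,n) Fourier–Jacobi coefficients fail
E-integrality control).
- Literature.Ba

Novelty grade: new-combination — ROUTE REVIEW #6 rreview-0815T12-7 (refuter, 08-16 ~07:40Z; rev 11 unchanged since 08-15 16:13Z; reviews d17a2435/0815T12-32/0815T12-5/g44×6/rattack-10368,-8485 STAND). VERDICT KEEP OPEN (theorem-candidate); no crux blocked; not a recombination (negatives: K3KugaSatake only). Re-probed at current tre (refuter refuter-rreview-0815T12-7-0, 2026-08-16T07:16:20Z; prior: arXiv:math/0702593 (BCL Thm 2/Prop 19); arXiv:2109.09040 (CDT Thm 1); arXiv:2008.07099 (Pan Thm 1.0.7); Coleman 1996; Katz 1973; Darmon-Lauder-Rotger Adv.Math.283 (2015); Coleman-Edixhoven Math.Ann.310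 (1998))

History (route lifecycle, newest last):
- 2026-08-15T14:42:08Z · rev 9: restated SectorToLanglands (stmt-Langlands-8461) — repair render regression (retriage g2): SectorToLanglands re-stated with the summit constant fully qualified (_root_.Langlands) — term text changes, meaning ide (planner-retriage-Langlands-CapacityClassicality-g2-0)
- 2026-08-15T14:42:47Z · rev 10: restated Assembly (stmt-Langlands-8462) — repair render regression (retriage g2), part 2: Assembly re-stated with the summit constant fully qualified (_root_.Langlands) — meaning identical — to clear th (planner-retriage-Langlands-CapacityClassicality-g2-0)
- 2026-08-15T16:13:08Z · rev 11: restated CongruenceToGalois (stmt-Langlands-8460), SectorToLanglands (stmt-Langlands-9860), Assembly (stmt-Langlands-9875) — route-repair (rbadge g4): deciding theorem `closes : IntegralOverconvergentIsCongruence → CongruenceToClassical → SectorToLanglands → Langlands := fun hα hαβ hβ (planner-rbadge-Langlands-CapacityClassicality-bf9b4a50-g4-0)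
- 2026-08-15T16:13:08Z · rev 11: dropped ERationalOverconvergentClassical, stmt-Langlands-8486, stmt-Langlands-8545 — route-repair (rbadge g4): deciding theorem `closes : IntegralOverconvergentIsCongruence → CongruenceToClassical → SectorToLanglands → Langlands := fun hα hαβ hβ (planner-rbadge-Langlands-CapacityClassicality-bf9b4a50-g4-0)
- 2026-08-16T19:09:33Z · rev 12: restated Assembly (stmt-Langlands-10369 proved) — route-repair (rground, ground-failed): Assembly (stmt-Langlands-10369) was flagged ground.trivial (tauto) — the rev-11 chain α → CongruenceToClassical → SectorT (planner-rground-Langlands-CapacityClassicality-bf9b4a50-0)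
- 2026-08-23T05:17:13Z · DORMANT — reconciler: no traction for 5.9 d (last activity item-evidence-added at 2026-08-17T06:27:22Z); parked, not closed — `ledger route dormant route-Langlands-Capaci (operator:999:3901963)

sub-problem: Langlands · status: dormant · opened planner-plancard-Langlands-Langlands-capacity-686ce87d-0 2026-08-15T12:51:22Z · rev 12 · ledger route-Langlands-CapacityClassicality
GENERATED by the gate from the ledger (D-0016/17). Provers cite these decls: `theorem foo : Summit.Langlands.Langlands.Theses.CapacityClassicality.<Decl> := …` in Summits/Langlands/Langlands/Theorems/<Name>.lean.
-/

namespace Summit.Langlands.Langlands.Theses.CapacityClassicality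

open scoped BigOperators Topology Manifold Classical MeasureTheory ProbabilityTheory Matrix InnerProductSpace ComplexConjugate ContinuousMap
open Filter Set Function TopologicalSpace MeasureTheory

attribute [summit_statement] _root_.Langlands

/-- item stmt-Langlands-8457 · crux · rank 2 · open · by planner
why it might fail: ONE O_E-integral radius-1 overconvergent g (k∈ℤ) with g·Δ^m never classical kills α; θ^(1−k)-integrals & Λ-adic k≤0 (denominators), 1/Hasse (radius), θ-critical companions (Bellaiche2009) fail; E-rational weight ≤1 points not excluded. Proof: a bad-place canonical term may beat gain (r log p)/s_N.
sources: BostChambertloir2007, CalegariDimitrovTang2025, arXiv:2109.09040, Katz1973, Coleman1996, Bellaiche2009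
[crux] THEOREM α over ℚ (card C1, corrected to "up to a power of Δ"): p ≥ 5 prime, N ≥ 1 with p ∤ N,
k ∈ ℤ, ι : ℚ̄_p ≃ ℂ, E a number field with an embedding σ₀, a : ℕ → O_E (algebraic integers). If Σ
σ(a_n) qⁿ has radius ≥ 1 for every σ : E → ℂ, and g := Σ σ₀(a_n) qⁿ is p-adically overconvergent of
weight k and tame level Γ₁(N) in the Katz-expansion sense (g = Σ_i c_i E_(p-1)^(−i) coefficientwise
in ℚ̄_p along ι⁻¹, c_i q-expansions of classical forms in M_(k+i(p−1))(Γ₁(N)), ‖ι⁻¹c_i‖ ≤ C p^(−ri),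
r > 0), then for some level M and m ≥ 0, g·Δ^m is the q-expansion of a classical modular form of
weight k + 12m on Γ₁(M). (The Δ-power is necessary: t = (η(pτ)/η(τ))^(24/(p−1)), p = 5, 7, 13, is
overconvergent of weight 0, integral, radius 1, with a pole at the cusp 0.) [difficulty: XL] -/
@[route_item "route-Langlands-CapacityClassicality", crux]
def IntegralOverconvergentIsCongruence : Prop :=
  ∀ (p : ℕ) [Fact p.Prime] (hp : 5 ≤ p) (N : ℕ) [NeZero N], ¬ p ∣ N → ∀ (k : ℤ) (ι : PadicAlgCl p ≃+* ℂ) (E : Type) [Field E] [NumberField E] (σ₀ : E →+* ℂ) (a : ℕ → E), (∀ n, IsIntegral ℤ (a n)) → (∀ (σ : E →+* ℂ) (t : ℝ), 0 < t → t < 1 → ∃ C : ℝ, ∀ n, ‖σ (a n)‖ * t ^ n ≤ C) → (∃ (r C : ℝ) (c : ℕ → PowerSeries ℂ), 0 < r ∧ (∀ i : ℕ, ∃ F : ModularForm (CongruenceSubgroup.Gamma1 N) (k + i * (p - 1 : ℕ)), c i = UpperHalfPlane.qExpansion 1 ⇑F) ∧ (∀ i n : ℕ, ‖ι.symm (PowerSeries.coeff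 n (c i))‖ ≤ C * (p : ℝ) ^ (-(r * i))) ∧ ∀ n : ℕ, HasSum (fun i : ℕ ↦ ι.symm (PowerSeries.coeff n (c i * ((UpperHalfPlane.qExpansion 1 ⇑(ModularForm.E (show 3 ≤ p - 1 by omega)))⁻¹) ^ i))) (ι.symm (σ₀ (a n)))) → ∃ (M : ℕ) (_ : NeZero M) (m : ℕ) (F : ModularForm (CongruenceSubgroup.Gamma1 M) (k + 12 * m)), UpperHalfPlane.qExpansion 1 ⇑F = PowerSeries.mk (fun n ↦ σ₀ (a n)) * (UpperHalfPlane.qExpansion 1 ⇑CuspForm.discriminant) ^ m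

/-- item stmt-Langlands-8927 · crux · rank 3 · open · by planner
why it might fail: ONE non-classical T_ℓ-eigen (ℓ∤Np) overconvergent q-expansion, a₁=1, O_E-integral, radius ≥1 kills β′: an E-rational eigencurve point of weight ≤1 (Hida2010 bounds Hecke fields only at classical points) or an overconvergent f-isotypic V-tower outside span(α^m,β^m); θ-critical companions fail.
sources: Coleman1996, Kisin2003, Hida2010, Bellaiche2009, Majumdar2013, BellaicheChenevier2004
[crux] (rank 3) COROLLARY β′ over ℚ at the q-expansion level — Mathlib-only replacement for β =
ERationalOverconvergentClassical (stmt-Langlands-8458), filed by the 2026-08-15 cone route-repair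
(unit rrepair-Langlands-CapacityClassicality-bf9b4a50); a tenure planner/operator completes the
repair with the prepared edit (drop 8458, re-point CongruenceToGalois/SectorToLanglands here,
imports := []), which removes Literature.NumberTheory.EllipticCurves.NewformGaloisRep and its 3
unproved XL facts (Deligne, Deligne–Serre, Eichler–Shimura) from the cone. STATEMENT: p ≥ 5, p ∤ N,
k ∈ ℤ, ι : ℚ̄_p ≃ ℂ, ψ a Dirichlet character mod N, E a number field with σ₀ : E → ℂ, a : ℕ → O_E
with a₁ = 1. If Σ σ(a_n) qⁿ has radius ≥ 1 for every σ : E → ℂ, g := Σ σ₀(a_n) qⁿ is p-adically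
overconvergent of weight k and tame level Γ₁(N) in the Katz-expansion sense along ι (exactly as in α
= IntegralOverconvergentIsCongruence), and g is T_ℓ-eigen in q-expansion form for every prime ℓ ∤ Np
(a_(ℓn) + ψ(ℓ)ℓ^(k−1) a_(n/ℓ) = a_ℓ a_n, n ≥ 1), then g ITSELF is the q-expansion of a classical
modular form of weight k on some Γ₁(M) — no Δ-power (k ≤ 0 thereby excluded). Follows from α by
cusp-pole removal alone (V_ℓ mu -/
@[route_item "route-Langlands-CapacityClassicality"]
def EigenIntegralOverconvergentIsClassical : Prop :=
  ∀ (p : ℕ) [Fact p.Prime] (hp : 5 ≤ p) (N : ℕ) [NeZero N], ¬ p ∣ N → ∀ (k : ℤ) (ι : PadicAlgCl p ≃+* ℂ) (E : Type) [Field E] [NumberField E] (σ₀ : E →+* ℂ) (a : ℕ → E) (ψ : DirichletCharacter ℂ N), a 1 = 1 → (∀ n, IsIntegral ℤ (a n)) → (∀ (σ : E →+* ℂ) (t : ℝ), 0 < t → t < 1 → ∃ C : ℝ, ∀ n, ‖σ (a n)‖ * t ^ n ≤ C) → (∃ (r C : ℝ) (c : ℕ → PowerSeries ℂ), 0 < r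 ∧ (∀ i : ℕ, ∃ F : ModularForm (CongruenceSubgroup.Gamma1 N) (k + i * (p - 1 : ℕ)), c i = UpperHalfPlane.qExpansion 1 ⇑F) ∧ (∀ i n : ℕ, ‖ι.symm (PowerSeries.coeff n (c i))‖ ≤ C * (p : ℝ) ^ (-(r * i))) ∧ ∀ n : ℕ, HasSum (fun i : ℕ ↦ ι.symm (PowerSeries.coeff n (c i * ((UpperHalfPlane.qExpansion 1 ⇑(ModularForm.E (show 3 ≤ p - 1 by omega)))⁻¹) ^ i))) (ι.symm (σ₀ (a n)))) → (∀ ℓ n : ℕ, ℓ.Prime → ¬ ℓ ∣ N * p → 0 < n → σ₀ (a (ℓ * n)) + (if ℓ ∣ n then ψ ℓ * (ℓ : ℂ) ^ (k - 1) * σ₀ (a (n / ℓ)) else 0) = σ₀ (a ℓ) * σ₀ (a n)) → ∃ (M : ℕ) (_ : NeZero M) (G : ModularForm (CongruenceSubgroup.Gamma1 M) k), UpperHalfPlane.qExpansion 1 ⇑G = PowerSeries.mk (fun n ↦ σ₀ (a n))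

-- item stmt-Langlands-8485 · crux · rank 4 · open · by planner — informal only, no Lean statement yet:
--   [crux] HILBERT ENGINE (card C2): F totally real, p >= 5 unramified in F and prime to the tame level
--   n, E a number field. Let g be an overconvergent Hilbert modular form (Andreatta-Iovita-Pilloni /
--   Kisin-Lai strict neighbourhood of the ordinary-multiplicative locus of the Hilbert modular variety
--   of level Gamma_1(n)) of INTEGER paritious weight (k_sigma) - partial weight one allowed - whose
--   q-expansion at the standard cusp has coefficients c(nu) in O_E and converges on the whole tube
--   domain (Im z totally positive) under every complex embedding of E. Then for some level m and some
--   classical form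

-- earlier SectorToLanglands (stmt-Langlands-8461, replaced 2026-08-15T14:42:08Z -> stmt-Langlands-9860): retired by None — ERationalOverconvergentClassical → Langlands
-- earlier SectorToLanglands (stmt-Langlands-9860, replaced 2026-08-15T16:13:08Z -> stmt-Langlands-10368): retired by None — ERationalOverconvergentClassical → _root_.Langlands
/-- item stmt-Langlands-10368 · crux · rank 9 · open · by planner
why it might fail: β′ → Langlands is the summit minus this route's sector (Galois dressing of β′, Hilbert engine, avatar supply, LGC, even ρ, non-totally-real F, n ≥ 3, (A), 𝓡): false iff the formal summit statement fails outside the totally-odd E-rational GL₂ sector while β′ holds. Imported complement — never glue.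
sources: BuzzardGeeLMS2014, FontaineMazurGeometric1995, DeligneSerreASENS1974, Literature.Barriers.Langlands.ShimuraVarietyRealizationBarrier, Literature.Barriers.Langlands.NonRegularWeightBarrier
[crux] (rank 9 = IMPORTED COMPLEMENT, never glue, not to be staffed from this route) OUT-OF-SCOPE
REMAINDER, filed only so that the deciding theorem honestly ends at the summit:
EigenIntegralOverconvergentIsClassical → Langlands. It contains the Galois dressing of β′
(Atkin–Lehner–Li newform of the eigensystem; Deligne / Deligne–Serre representations — the
Literature facts exists_padicGaloisRep_of_isNewform1 / exists_complexGaloisRep_of_weight_one,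
deliberately NOT imported by this route; Chebotarev + Brauer–Nesbitt), the informal layer-1 cruxes
of this route over totally real F (HilbertIntegralOverconvergentIsCongruence rank 4;
OverconvergentAvatarSupply, to be filed when Hilbert q-expansions are typable), local–global
compatibility at every place for the classical π produced (Carayol, Saito, Skinner; T. Liu), and
everything this thesis does not claim: even ρ, non-totally-real F, n ≥ 3, direction (A), the
reciprocity data 𝓡. [difficulty: open-problem] -/
@[route_item "route-Langlands-CapacityClassicality", crux]
def SectorToLanglands : Prop :=
  EigenIntegralOverconvergentIsClassical → _root_.Langlands

/-- item stmt-Langlands-10367 · support · rank 9 · closed · proved by Summit.Langlands.Langlands.Theorems.congruenceToClassical_proof @ 4b795e21ce4f (prover) · by planner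
sources: DeligneSerreASENS1974, Ribet1977Nebentypus, AtkinLehner1970
[support] Glue α → β′ (replaces CongruenceToGalois = α → β, whose target β =
ERationalOverconvergentClassical was dropped at the 2026-08-15 cone repair): from α, g = F/Δ^m is a
meromorphic modular form of weight k on Γ₁(M), holomorphic on ℍ and at ∞; a T_ℓ-eigen (one prime ℓ ∤
MNp suffices) meromorphic form is holomorphic at every cusp — in U_ℓ g + ψ(ℓ)ℓ^(k−1) V_ℓ g = a_ℓ g
the V_ℓ-term has exponential growth rate ℓ·R(g) at the worst cusp while every other term has rate ≤
R(g), so R(g) = 0 — hence g is a classical modular form of weight k on Γ₁(M) with q-expansion Σ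
σ₀(a_n) qⁿ, which is β′'s conclusion. Weight k ≤ 0 is vacuous (a₁ = 1 + integrality of a(ℓ²)).
Mathlib-level ingredients: slash action and cusps of Γ₁(M), qExpansion injectivity, U_ℓ / V_ℓ on
q-expansions (level Mℓ). [deps: IntegralOverconvergentIsCongruence,
EigenIntegralOverconvergentIsClassical] [difficulty: L] -/
@[route_item "route-Langlands-CapacityClassicality", crux]
def CongruenceToClassical : Prop :=
  IntegralOverconvergentIsCongruence → EigenIntegralOverconvergentIsClassical

/-- item stmt-Langlands-8459 · support · rank 9 · closed · proved by Summit.Langlands.Langlands.Theorems.CapacityClassicality.archimedeanSlackNeeded_proof @ 00fcba88798a (prover) · by planner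
sources: Katz1973, Coleman1996
[support] Sharpness of α (the archimedean term is load-bearing): for p = 5, g = 1/E₄ has a one-term
Katz expansion (c₁ = 1, weight −4 + 4 = 0), integer coefficients, and g·Δ^m is never classical
(E₄(ρ) = 0 from S- and T-invariance at ρ = e^(2πi/3), Δ(ρ) ≠ 0); its complex radius is e^(−π√3) < 1.
Provable from Mathlib (qExpansion injectivity, slash invariance of E₄, discriminant_ne_zero).
[difficulty: M] -/
@[route_item "route-Langlands-CapacityClassicality"]
def ArchimedeanSlackNeeded : Prop :=
  ∀ [Fact (Nat.Prime 5)] (ι : PadicAlgCl 5 ≃+* ℂ), (∃ (r C : ℝ) (c : ℕ → PowerSeries ℂ), 0 < r ∧ (∀ i : ℕ, ∃ F : ModularForm (CongruenceSubgroup.Gamma1 1) ((-4 : ℤ) + i * (5 - 1 : ℕ)), c i = UpperHalfPlane.qExpansion 1 ⇑F) ∧ (∀ i n : ℕ, ‖ι.symm (PowerSeries.coeff n (c i))‖ ≤ C * (5 : ℝ) ^ (-(r * i))) ∧ ∀ n : ℕ, HasSum (fun i : ℕ ↦ ι.symm (PowerSeries.coeff n (c i * ((UpperHalfPlane.qExpansion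 1 ⇑(ModularForm.E (show 3 ≤ 5 - 1 by omega)))⁻¹) ^ i))) (ι.symm (PowerSeries.coeff n ((UpperHalfPlane.qExpansion 1 ⇑ModularForm.E₄)⁻¹)))) ∧ (∀ n : ℕ, IsIntegral ℤ (PowerSeries.coeff n ((UpperHalfPlane.qExpansion 1 ⇑ModularForm.E₄)⁻¹))) ∧ ¬ ∃ (M : ℕ) (_ : NeZero M) (m : ℕ) (F : ModularForm (CongruenceSubgroup.Gamma1 M) ((-4 : ℤ) + 12 * m)), UpperHalfPlane.qExpansion 1 ⇑F = (UpperHalfPlane.qExpansion 1 ⇑ModularForm.E₄)⁻¹ * (UpperHalfPlane.qExpansion 1 ⇑CuspForm.discriminant) ^ m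

-- earlier Assembly (stmt-Langlands-10369, replaced 2026-08-16T19:09:33Z -> stmt-Langlands-16408): proved by Summit.Langlands.Langlands.Theorems.capacityClassicality_assembly_proof — IntegralOverconvergentIsCongruence → CongruenceToClassical → SectorToLanglands → _root_.Langlands
-- earlier Assembly (stmt-Langlands-8462, replaced 2026-08-15T14:42:47Z -> stmt-Langlands-9875): retired by None — IntegralOverconvergentIsCongruence → CongruenceToGalois → SectorToLanglands → Langlands
-- earlier Assembly (stmt-Langlands-9875, replaced 2026-08-15T16:13:08Z -> stmt-Langlands-10369): retired by None — IntegralOverconvergentIsCongruence → CongruenceToGalois → SectorToLanglands → _root_.Langlands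
/-- item stmt-Langlands-16408 · assembly · rank 1 · closed · proved by Summit.Langlands.Langlands.Theorems.capacityClassicality_assembly_proof @ 4ac49efd3fae (prover) · by planner
sources: BostChambertloir2007, CalegariDimitrovTang2025
[assembly] CRUX-ONLY ASSEMBLY (route-repair 2026-08-16, ground-failed):
IntegralOverconvergentIsCongruence → SectorToLanglands → Langlands. The rev-11 form α →
CongruenceToClassical → SectorToLanglands → Langlands unfolds to a propositional tautology (both
middle items are themselves implications α → β′ and β′ → Langlands), which the gate's ground battery
flags `ground.trivial: tauto`; here the support CongruenceToClassical (α → β′, PROVED: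
Summit.Langlands.Langlands.Theorems.congruenceToClassical_proof in
Theorems/CapacityClassicalityCongruenceToClassical.lean) is discharged INSIDE the proof, as D-0027
§2.1 prescribes for proved non-crux hypotheses. Provable now, but not by logic alone (it needs the
cusp-pole-removal theorem α → β′): `fun hα hβL => hβL (congruenceToClassical_proof hα)` after
`import Summits.Langlands.Langlands.Theorems.CapacityClassicalityCongruenceToClassical`. The
deciding theorem `closes : IntegralOverconvergentIsCongruence → CongruenceToClassical →
SectorToLanglands → Langlands := fun hα hαβ hβL => hβL (hαβ hα)` is unchanged. Migration note:
Theorems/CapacityClassicalityAssembly.lean (capacityClassicality_assembly_proof, which proved the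
rev-11 tautology by un -/
@[route_item "route-Langlands-CapacityClassicality"]
def Assembly : Prop :=
  IntegralOverconvergentIsCongruence → SectorToLanglands → _root_.Langlands

-- records of items no longer active in this route (dropped / restated):
-- earlier CongruenceToGalois (stmt-Langlands-8460, replaced 2026-08-15T16:13:08Z -> stmt-Langlands-10367): retired by None — IntegralOverconvergentIsCongruence → ERationalOverconvergentClassical

/-! D-0027 §2.1 — DECIDING THEOREM (planner-authored via `route open/edit --closes-file`; by planner-rbadge-Langlands-CapacityClassicality-bf9b4a50-g4-0 2026-08-15T16:13:08Z):
its hypotheses are this route's items and its conclusion the sub-problem Statement (glue_lint), and it elaborates with this file. -/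

@[closes "route-Langlands-CapacityClassicality"] theorem closes (hα : IntegralOverconvergentIsCongruence) (hαβ : CongruenceToClassical) (hβL : SectorToLanglands) : _root_.Langlands := hβL (hαβ hα)

end Summit.Langlands.Langlands.Theses.CapacityClassicality
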